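import Mathlib
import HarnessLib
import Summits.QuantumFields.YangMills.Theses.LangevinControlUV
import Summits.QuantumFields.YangMills.Theorems.FemtoCurvatureSkewness.Negative.ZeroCoupling
import Summits.QuantumFields.YangMills.Theorems.FemtoCurvatureSkewness.Negative.WeakCoupling
import Summits.QuantumFields.YangMills.Theorems.FemtoCurvatureSkewness.Negative.WildPackage
import Summits.QuantumFields.YangMills.Theorems.FemtoCurvatureSkewness.Negative.FalseOfUniformZeros
import Summits.QuantumFields.YangMills.Theorems.LangevinControlUVFemtoCurvatureSkewnessHypercubicCovSymmetry
import Summits.QuantumFields.YangMills.Theorems.LangevinControlUVFemtoCurvatureSkewnessPermanentalRigidity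
import Summits.QuantumFields.YangMills.Theorems.LangevinControlUVFemtoCurvatureSkewnessPerpPropagatorPos

/-!
# Line `wick-triangle-ratio` — crux `LangevinControlUV.FemtoCurvatureSkewness` (item stmt-QuantumFields-9365)

Skeleton v1 (crux-plan planner, 2026-08-16) of idea card `Ideas/wick-triangle-ratio.md` (triage r1-1 / r1-2: pass;
merged lever-wise with `skeleton-ratio` ≈ `permanental-rigidity`, whose line `Lines/Sketch_ideator3.lean` is the lead's pick).
Written over the LANDED vocabulary of the crux (`Theorems/FemtoCurvatureSkewness/Negative/ZeroCoupling.lean`: `plaq`, `wCov`,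
`kappa3`, `TwoPointPackage`, `SkewnessPackage`; the crux is definitionally `∀ G simple, ∀ r a, TwoPointPackage r a →
SkewnessPackage r a`, `crux_iff` below is `Iff.rfl`).

## The line
Wick/Isserlis rigidity (landed: `PermanentalRigidity`): for a colour-diagonal centred Gaussian multiplet and `P = λ Σ_a (F^a)²`,
`κ₃(P_x,P_y,P_z)² = (8/dim G)·Cov(P_x,P_y)Cov(P_y,P_z)Cov(P_z,P_x)` EXACTLY, for ANY covariance (so also for every twisted /
zero-mode-removed torus propagator).  Hence near the Gaussian point the crux's normalised skewness is slaved to the three pair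
covariances through two dimensionless, renormalisation-free ratios, `R := κ₃²/(C₀₂C₀₃C₂₃)` (target `8/dim G`) and
`ρ := C₂₃/C₀₂` (target: lattice Maxwell, `∈ [0.024, 0.084] → 1/16`), and the crux's lower bound follows from `R ≥ R₀`,
`ρ ≥ ρ₀`, `C₀₃ = C₀₂` (hypercubic symmetry, landed) and the LOWER clause of the two-point package, with `Γ₃ := Γ^{3/2}`.

## What is new in this skeleton (vs `Lines/Sketch_ideator3.lean`)
1. **Every stub is `a`-free.**  No stub mentions a unit map or the two-point package: the `∀ a` shell of the typed crux is
   absorbed ONCE, in the kernel-checked glue `FemtoCurvatureSkewness_of`, which serves an arbitrary package map `a` from its OWN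
   `Γ` (level sets are never booked — card point (4); Disproof finding 2 `skewnessPackage_iff_levelwise`).  In particular the
   line does NOT use the lead's residual `PackagePinsScale` ("package maps are comparable"), which is false modulo covariance
   uniformities (`Negative/WildPackage.lean: exists_incomparable_packages`).
2. **The engine target is the RATIO form** (card point (3)): two one-sided inequalities between MEASURED torus quantities,
   `R₀·C₀₂C₀₃C₂₃ ≤ κ₃²` (`WickRatioFemto`) and `ρ₀·C₀₂ ≤ C₂₃` (`DiagonalCovarianceFemto`) — no reference Gaussian numbers, no
   accuracy, no `Z`-factor, no `Γ`; strictly weaker than the lead's `CouplingBounds` (relative accuracy 1/8 on four quantities),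
   so any proof of the lead's engine stub closes both (via the landed `DominanceFromCoupling` algebra).
3. **The engine region is explicit and `a`-free**: tori with `L ≤ β` at `β ≥ β_E` ("deep-femto + fixed-torus corner": under any
   asymptotically free unit map their physical size `β·a(β) → 0`; every fixed torus enters eventually).  This is the regime of
   the sibling card `toron-resolved-corner` made UNIFORM over `L ≤ β`, and it is where the toron caveats live (triage note T:
   SU(2) toron valley marginal — harmless for two-sided RATIO bounds, fatal only for rates).
4. **The honest remainder is ONE `a`-free floor statement**, `SkewnessFloorBeyond`: on tori with `L > β`, wherever the
   normalised axis two-point function `n⁸C₀₂` lies in a fixed window `[γlo, γhi]` (`γlo > 0`), the normalised skewness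
   `n¹²|κ₃|` has a positive floor depending only on the window.  The window is the `a`-free shadow of a level set `n·a(β) = s`
   (the package pins `n⁸C₀₂ ∈ [cΓ(s), CΓ(s)]` there).  It contains (i) the fixed-size femto content of the crux in floor form
   (UV branch of the window: Wick triangle, `+`) and (ii) the open infrared sign question (IR branch: Disproof finding 3;
   `Negative/FalseOfUniformZeros.lean`).  It is refutable exactly by zeros of `κ₃` at arbitrarily large `β` in boxes `L > β` —
   the same exposure as the typed crux — and NOT by the uniformities alone.

## Registered stubs (3; `sorry` only in namespace `Stub`, whole-body, the form `ledger skeleton check` registers)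
* `WickRatioFemto`          — E_R, three-point vs two-point (Wick ratio floor) on `L ≤ β` boxes.      [L]
* `DiagonalCovarianceFemto` — E_ρ, two-point 45° comparability on `L ≤ β` boxes.                    [M–L]
* `SkewnessFloorBeyond`     — F, window floor of `n¹²|κ₃|` on `L > β` boxes (hardest; carries the IR sign). [XL/open]
Composition: `FemtoCurvatureSkewness_of : WickRatioFemto → DiagonalCovarianceFemto → SkewnessFloorBeyond →
FemtoCurvatureSkewness` (kernel-checked, no `sorry`), `Γ₃(s) := min (√(R₀ρ₀)·(cΓ(s))^{3/2}) (φ(cΓ(s), CΓ(s)))`,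
`β₁ := max(β₀, β_R, β_ρ, β₂)`, `ℓ₁ := ℓ₀`, `c₃ := 1`.

## Disproof.lean (cdisprove v4) / Negative lemmas honoured
* finding 4 `kappa3_zero_coupling` (β = 0 exact zero; `β₁` load-bearing): every stub carries a coupling threshold.
* finding 4b `tendsto_kappa3` / `not_uniformSkewness` (Γ₃ must vanish at 0⁺): `Γ₃ ≤ √(R₀ρ₀)(cΓ)^{3/2} → 0` with `Γ`; the
  floors of F are per-window, so `n¹²|κ₃| → 0` as the window slides to `0` is allowed; E_R/E_ρ are RATIO bounds, scale-free.
* finding 2 `skewnessPackage_iff_levelwise`: the glue realises `Γ₃` as a function of the package's `Γ` through windows.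
* finding 3 / `FemtoCurvatureSkewness_false_of_UniformZeros`: `UniformZeros → ¬(E_R ∧ E_ρ ∧ F)` (`stubs_false_of_uniformZeros`
  below, kernel-checked): zeros in `L ≤ β` boxes would hit E_R ∧ E_ρ (they contradict the toron-resolved semiclassics: all three
  transverse kernels `> 0`, landed `PerpPropagatorPos`), zeros in `L > β` boxes hit F — the open IR sign, isolated by name.
* finding 5: no `_false_without_` theorem exists to honour; none of the 4 negatives (9494, 9599, 9603, 9665) bears on
  cumulants; E_ρ is not an RP claim (9665, diagonal mirror) — it is a weak-coupling comparability with threshold `β_E`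
  (MC j008977: `cov_diag > 0` for `β_std ≥ 1.6`, `< 0` only at `β_std = 1.0`).
-/

noncomputable section

namespace Summit.QuantumFields.YangMills.Cruxes.FemtoCurvatureSkewness.WickTriangleRatio

open MeasureTheory Filter Topology
open scoped BigOperators
open Literature.MathematicalPhysics.QuantumFieldTheory
open Summit.QuantumFields.YangMills.Theses.LangevinControlUV (FemtoCurvatureSkewness)
open Summit.QuantumFields.YangMills.Theorems.FemtoCurvatureSkewness.Negative
  (plaq wE wCov kappa3 TwoPointPackage SkewnessPackage level_mem_window UniformZeros
    FemtoCurvatureSkewness_false_of_UniformZeros)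

/-! ## Statements of the line (all `a`-free; `C₀₂ = Cov(P_0^{01},P_{ne₂}^{01})`, `C₀₃ = Cov(P_0^{01},P_{ne₃}^{01})`,
`C₂₃ = Cov(P_{ne₂}^{01},P_{ne₃}^{01})`, `κ₃ = kappa3 r L β n`, all on the torus `(ℤ/L)⁴` at coupling `β`) -/

/-- **Stub E_R `WickRatioFemto` (the Wick-triangle ratio floor in the deep-femto / fixed-torus corner).**  For every compact
simple `G` and lattice representation `r` there are `R₀ > 0` and `β_E` such that on every torus `(ℤ/L)⁴` with `L ≤ β` at
coupling `β ≥ β_E`, for `1 ≤ n ≤ L/8`:  `R₀ · C₀₂ · C₀₃ · C₂₃ ≤ κ₃²`.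
Tree level: `R = κ₃²/(C₀₂C₀₃C₂₃) = 8/dim G` EXACTLY for every colour-diagonal Gaussian covariance (landed `PermanentalRigidity`),
so only interaction and toron-mixture corrections move `R` (each twisted sector within 10 %, constant-mode dressing `(n/L)⁴ ≤
2.4·10⁻⁴`; MC j008977: `ρ√3 = κ₃/C₀₂^{3/2}·√3 = 0.80–0.82` vs tree `0.8156` for `β_std ≥ 2.4` on `8⁴`).  Expected `R₀ = 4/dim G`. -/
def WickRatioFemto : Prop :=
  ∀ (G : Type) [Group G] [TopologicalSpace G] [IsTopologicalGroup G] [CompactSpace G]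
    [MeasurableSpace G] [BorelSpace G], IsCompactSimpleLieGroup G → ∀ (r : LatticeRep G),
    ∃ R₀ βE : ℝ, 0 < R₀ ∧
      ∀ (L : ℕ) [NeZero L] (β : ℝ) (n : ℕ), βE ≤ β → (L : ℝ) ≤ β → 1 ≤ n → 8 * n ≤ L →
        R₀ * (wCov r L β (plaq r L 0 0 1) (plaq r L (Pi.single (2 : Fin 4) ((n : ℕ) : ZMod L)) 0 1) *
            wCov r L β (plaq r L 0 0 1) (plaq r L (Pi.single (3 : Fin 4) ((n : ℕ) : ZMod L)) 0 1) *
            wCov r L β (plaq r L (Pi.single (2 : Fin 4) ((n : ℕ) : ZMod L)) 0 1)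
              (plaq r L (Pi.single (3 : Fin 4) ((n : ℕ) : ZMod L)) 0 1)) ≤
          (kappa3 r L β n) ^ 2

/-- **Stub E_ρ `DiagonalCovarianceFemto` (two-point 45° comparability in the same corner).**  For every compact simple `G`
and `r` there are `ρ₀ > 0` and `β_E` such that on every torus with `L ≤ β`, `β ≥ β_E`, `1 ≤ n ≤ L/8`:
`ρ₀ · C₀₂ ≤ C₂₃` — the diagonal pair (displacement `n(e₃ − e₂)`, transverse to the plaquette plane) carries at least a fixed
fraction of the axis covariance.  Tree level: `ρ = (G_L(n(e₂−e₃))/G_L(ne₂))² ∈ [0.0239, 0.0837] → 1/16`, both kernels `> 0`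
for all `(n, L)` (landed `PerpPropagatorPos`, 2-d Yukawa slicing).  A pure TWO-POINT statement (9363-grade engine output;
genuinely extra w.r.t. the package, which bounds `C₂₃` only from above — triage r1-2); not an RP claim (negatives 9665). -/
def DiagonalCovarianceFemto : Prop :=
  ∀ (G : Type) [Group G] [TopologicalSpace G] [IsTopologicalGroup G] [CompactSpace G]
    [MeasurableSpace G] [BorelSpace G], IsCompactSimpleLieGroup G → ∀ (r : LatticeRep G),
    ∃ ρ₀ βE : ℝ, 0 < ρ₀ ∧
      ∀ (L : ℕ) [NeZero L] (β : ℝ) (n : ℕ), βE ≤ β → (L : ℝ) ≤ β → 1 ≤ n → 8 * n ≤ L →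
        ρ₀ * wCov r L β (plaq r L 0 0 1) (plaq r L (Pi.single (2 : Fin 4) ((n : ℕ) : ZMod L)) 0 1) ≤
          wCov r L β (plaq r L (Pi.single (2 : Fin 4) ((n : ℕ) : ZMod L)) 0 1)
            (plaq r L (Pi.single (3 : Fin 4) ((n : ℕ) : ZMod L)) 0 1)

/-- **Stub F `SkewnessFloorBeyond` (the `a`-free remainder: a floor of the normalised skewness at fixed two-point window,
beyond the corner).**  For every compact simple `G` and `r` there is `β₂` such that for every window `[γlo, γhi]` with
`γlo > 0` there is `φ > 0` with: on every torus with `L > β` at `β ≥ β₂`, for `1 ≤ n ≤ L/8`,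
`γlo ≤ n⁸C₀₂ ≤ γhi  ⟹  φ ≤ n¹²|κ₃|`.
The window replaces the level set `n·a(β) = s` of a package map (`n⁸C₀₂ ∈ [cΓ(s), CΓ(s)]` there), so `β₂` is uniform and `φ`
may degrade as the window slides to `0` (tightness `not_uniformSkewness`).  UV branch of a window (physically small separations,
any femto box of fixed size): floor = Wick triangle `> 0`.  IR branch (confinement-scale separations in large boxes): floor ⇔ no
zeros of `κ₃` at arbitrarily large `β` — the open infrared sign of `⟨trF² trF² trF²⟩_c` (Disproof finding 3; strong-coupling
sign is `(G,r)`-dependent), i.e. exactly the surplus of the typed `∀ a` crux (`Negative/FalseOfUniformZeros.lean`). -/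
def SkewnessFloorBeyond : Prop :=
  ∀ (G : Type) [Group G] [TopologicalSpace G] [IsTopologicalGroup G] [CompactSpace G]
    [MeasurableSpace G] [BorelSpace G], IsCompactSimpleLieGroup G → ∀ (r : LatticeRep G),
    ∃ β₂ : ℝ, ∀ γlo γhi : ℝ, 0 < γlo → ∃ φ : ℝ, 0 < φ ∧
      ∀ (L : ℕ) [NeZero L] (β : ℝ) (n : ℕ), β₂ ≤ β → β < (L : ℝ) → 1 ≤ n → 8 * n ≤ L →
        γlo ≤ (n : ℝ) ^ 8 * wCov r L β (plaq r L 0 0 1) (plaq r L (Pi.single (2 : Fin 4) ((n : ℕ) : ZMod L)) 0 1) →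
        (n : ℝ) ^ 8 * wCov r L β (plaq r L 0 0 1) (plaq r L (Pi.single (2 : Fin 4) ((n : ℕ) : ZMod L)) 0 1) ≤ γhi →
          φ ≤ (n : ℝ) ^ 12 * |kappa3 r L β n|

/-! ## Registered stubs `Stub.<Name>` (`sorry` lives only here) -/

namespace Stub

/-- Stub E_R (Wick ratio floor), registered form (statement = def `WickRatioFemto`, by name). -/
theorem WickRatioFemto :
    Summit.QuantumFields.YangMills.Cruxes.FemtoCurvatureSkewness.WickTriangleRatio.WickRatioFemto := by
  sorry

/-- Stub E_ρ (diagonal covariance comparability), registered form (statement = def `DiagonalCovarianceFemto`, by name). -/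
theorem DiagonalCovarianceFemto :
    Summit.QuantumFields.YangMills.Cruxes.FemtoCurvatureSkewness.WickTriangleRatio.DiagonalCovarianceFemto := by
  sorry

/-- Stub F (skewness floor beyond the corner), registered form (statement = def `SkewnessFloorBeyond`, by name). -/
theorem SkewnessFloorBeyond :
    Summit.QuantumFields.YangMills.Cruxes.FemtoCurvatureSkewness.WickTriangleRatio.SkewnessFloorBeyond := by
  sorry

end Stub

/-! ## The composition (kernel-checked; no `sorry` below this line) -/

/-- **The crux, unbundled** (definitional: the route decl IS `∀ G simple, ∀ r a, TwoPointPackage → SkewnessPackage`). -/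
theorem crux_iff : FemtoCurvatureSkewness ↔
    ∀ (G : Type) [Group G] [TopologicalSpace G] [IsTopologicalGroup G] [CompactSpace G],
      IsCompactSimpleLieGroup G →
        letI : MeasurableSpace G := borel G
        haveI : BorelSpace G := ⟨rfl⟩
        ∀ (r : LatticeRep G) (a : ℝ → ℝ), TwoPointPackage r a → SkewnessPackage r a :=
  Iff.rfl

/-- **Closing algebra of the card** (`Sketch.closure_algebra`, real numbers only): a Wick-ratio floor `R₀·X·Y·D ≤ k²`, the
symmetry `Y = X`, the diagonal comparability `ρ₀·X ≤ D` and a lower bound `0 < g ≤ X` give `√(R₀ρ₀)·g·√g ≤ |k|`. -/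
theorem closure_algebra {R₀ ρ₀ X Y D k g : ℝ} (hR₀ : 0 < R₀) (hρ₀ : 0 < ρ₀) (hg : 0 < g) (hgX : g ≤ X)
    (hY : Y = X) (hR : R₀ * (X * Y * D) ≤ k ^ 2) (hρ : ρ₀ * X ≤ D) :
    Real.sqrt (R₀ * ρ₀) * (g * Real.sqrt g) ≤ |k| := by
  rw [hY] at hR
  have hX : 0 < X := lt_of_lt_of_le hg hgX
  -- `R₀ ρ₀ X³ ≤ k²`
  have key : R₀ * ρ₀ * (X * X * X) ≤ k ^ 2 := by
    have h1 : R₀ * (X * X * (ρ₀ * X)) ≤ R₀ * (X * X * D) :=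
      mul_le_mul_of_nonneg_left (mul_le_mul_of_nonneg_left hρ (mul_nonneg hX.le hX.le)) hR₀.le
    calc R₀ * ρ₀ * (X * X * X) = R₀ * (X * X * (ρ₀ * X)) := by ring
      _ ≤ R₀ * (X * X * D) := h1
      _ ≤ k ^ 2 := hR
  -- `g √g ≤ X √X`
  have hmono : g * Real.sqrt g ≤ X * Real.sqrt X :=
    mul_le_mul hgX (Real.sqrt_le_sqrt hgX) (Real.sqrt_nonneg _) hX.le
  have habs : |k| = Real.sqrt (k ^ 2) := (Real.sqrt_sq_eq_abs k).symm
  calc Real.sqrt (R₀ * ρ₀) * (g * Real.sqrt g)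
      ≤ Real.sqrt (R₀ * ρ₀) * (X * Real.sqrt X) := mul_le_mul_of_nonneg_left hmono (Real.sqrt_nonneg _)
    _ ≤ |k| := by
        rw [habs]
        apply Real.le_sqrt_of_sq_le
        have h2 : (Real.sqrt (R₀ * ρ₀) * (X * Real.sqrt X)) ^ 2 = R₀ * ρ₀ * (X * X * X) := by
          rw [mul_pow, mul_pow, Real.sq_sqrt (by positivity : (0 : ℝ) ≤ R₀ * ρ₀), Real.sq_sqrt hX.le]
          ring
        rw [h2]
        exact key

/-- **`FemtoCurvatureSkewness_of`** — the glue of the line over exactly the three open stubs (hypercubic symmetry is the landed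
theorem `HypercubicCovSymmetry`).  Given an ARBITRARY package map `a` with shape `Γ` and constants `(β₀, ℓ₀, c, C)`:
`β₁ := max (max β₀ β_R) (max β_ρ β₂)`, `ℓ₁ := ℓ₀`, `c₃ := 1`,
`Γ₃(s) := min (√(R₀ρ₀)·(cΓ s)·√(cΓ s)) (φ (cΓ s) (CΓ s))`; on an admissible box with `L ≤ β` the corner stubs and the
package's LOWER clause give the first branch (`closure_algebra`), on a box with `L > β` the floor stub at the window
`[cΓ(s), CΓ(s)]` (both package clauses) gives the second.  No level set of `a` is ever booked. -/
theorem FemtoCurvatureSkewness_of (hR : WickRatioFemto) (hρ : DiagonalCovarianceFemto) (hF : SkewnessFloorBeyond) :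
    FemtoCurvatureSkewness := by
  rw [crux_iff]
  intro G _ _ _ _ hG
  letI : MeasurableSpace G := borel G
  haveI : BorelSpace G := ⟨rfl⟩
  intro r a hPkg
  obtain ⟨Γ, β₀, ℓ₀, c, C, hℓ₀, hc, ha, -, hΓ, hpack⟩ := hPkg
  obtain ⟨R₀, βR, hR₀, hRb⟩ := hR G hG r
  obtain ⟨ρ₀, βρ, hρ₀, hρb⟩ := hρ G hG r
  obtain ⟨β₂, hFb⟩ := hF G hG r
  choose! φ hφ0 hφ using hFb
  refine ⟨fun s => min (Real.sqrt (R₀ * ρ₀) * ((c * Γ s) * Real.sqrt (c * Γ s))) (φ (c * Γ s) (C * Γ s)),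
    max (max β₀ βR) (max βρ β₂), ℓ₀, 1, hℓ₀, one_pos, ?_, ?_⟩
  · -- positivity of `Γ₃` on `(0, ℓ₀]`
    intro s hs hsℓ
    have hΓs : 0 < c * Γ s := mul_pos hc (hΓ s hs hsℓ).1
    refine lt_min ?_ (hφ0 _ _ hΓs)
    positivity
  · intro L _ β hβ hL n hn h8
    have hβ₀ : β₀ ≤ β := le_trans (le_trans (le_max_left _ _) (le_max_left _ _)) hβ
    have hβR : βR ≤ β := le_trans (le_trans (le_max_right _ _) (le_max_left _ _)) hβ
    have hβρ : βρ ≤ β := le_trans (le_trans (le_max_left _ _) (le_max_right _ _)) hβ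
    have hβ₂ : β₂ ≤ β := le_trans (le_trans (le_max_right _ _) (le_max_right _ _)) hβ
    obtain ⟨hs, hsℓ⟩ := level_mem_window ha hL hn h8
    have hΓs : 0 < c * Γ ((n : ℝ) * a β) := mul_pos hc (hΓ _ hs hsℓ).1
    obtain ⟨hlow, hup⟩ := (hpack L β hβ₀ hL).1 n hn h8
    rw [one_mul]
    by_cases hLβ : (L : ℝ) ≤ β
    · -- corner box: Wick ratio floor + diagonal comparability + hypercubic symmetry + package LOWER clause
      refine le_trans (min_le_left _ _) ?_
      have hsym := Summit.QuantumFields.YangMills.Theorems.FemtoCurvatureSkewness.HypercubicCovSymmetry G r L β n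
      have hR' := hRb L β n hβR hLβ hn h8
      have hρ' := hρb L β n hβρ hLβ hn h8
      set X := wCov r L β (plaq r L 0 0 1) (plaq r L (Pi.single (2 : Fin 4) ((n : ℕ) : ZMod L)) 0 1) with hXdef
      set Y := wCov r L β (plaq r L 0 0 1) (plaq r L (Pi.single (3 : Fin 4) ((n : ℕ) : ZMod L)) 0 1) with hYdef
      set D := wCov r L β (plaq r L (Pi.single (2 : Fin 4) ((n : ℕ) : ZMod L)) 0 1)
        (plaq r L (Pi.single (3 : Fin 4) ((n : ℕ) : ZMod L)) 0 1) with hDdef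
      set k := kappa3 r L β n with hkdef
      have hn0 : (0 : ℝ) < (n : ℝ) ^ 8 := by positivity
      -- normalised quantities
      have hRn : R₀ * (((n : ℝ) ^ 8 * X) * ((n : ℝ) ^ 8 * Y) * ((n : ℝ) ^ 8 * D)) ≤ ((n : ℝ) ^ 12 * k) ^ 2 := by
        have : R₀ * (((n : ℝ) ^ 8 * X) * ((n : ℝ) ^ 8 * Y) * ((n : ℝ) ^ 8 * D)) =
            ((n : ℝ) ^ 12) ^ 2 * (R₀ * (X * Y * D)) := by ring
        rw [this, mul_pow]
        exact mul_le_mul_of_nonneg_left hR' (by positivity)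
      have hρn : ρ₀ * ((n : ℝ) ^ 8 * X) ≤ (n : ℝ) ^ 8 * D := by
        have : ρ₀ * ((n : ℝ) ^ 8 * X) = (n : ℝ) ^ 8 * (ρ₀ * X) := by ring
        rw [this]
        exact mul_le_mul_of_nonneg_left hρ' hn0.le
      have hYX : (n : ℝ) ^ 8 * Y = (n : ℝ) ^ 8 * X := by rw [hsym]
      have key := closure_algebra hR₀ hρ₀ hΓs hlow hYX hRn hρn
      rwa [abs_mul, abs_of_nonneg (by positivity : (0 : ℝ) ≤ (n : ℝ) ^ 12)] at key
    · -- beyond the corner: the floor stub at the window `[cΓ(s), CΓ(s)]`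
      rw [not_le] at hLβ
      exact le_trans (min_le_right _ _) (hφ _ _ hΓs L β n hβ₂ hLβ hn h8 hlow hup)

/-- **The skeleton**: the crux modulo exactly the three registered stubs `Stub.*`. -/
theorem FemtoCurvatureSkewness_proof : FemtoCurvatureSkewness :=
  FemtoCurvatureSkewness_of Stub.WickRatioFemto Stub.DiagonalCovarianceFemto Stub.SkewnessFloorBeyond

/-! ## Where the Negative lemma bites (kernel-checked bookkeeping of the exposure) -/

/-- **`UniformZeros` kills the conjunction of the three stubs** (via the landed `FemtoCurvatureSkewness_false_of_UniformZeros`):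
zeros of `κ₃` at arbitrarily large `β` in boxes `L ≤ β` would refute `WickRatioFemto ∧ DiagonalCovarianceFemto` (a zero forces
`C₀₂²·C₂₃ ≤ 0` against `ρ₀C₀₂ ≤ C₂₃`, `C₀₂ > 0`), zeros in boxes `L > β` refute `SkewnessFloorBeyond` — the open infrared
sign, isolated by name.  None of the three is refuted by the uniformities ALONE (contrast `PackagePinsScale`). -/
theorem stubs_false_of_uniformZeros (hU : UniformZeros) :
    ¬ (WickRatioFemto ∧ DiagonalCovarianceFemto ∧ SkewnessFloorBeyond) := fun h =>
  FemtoCurvatureSkewness_false_of_UniformZeros hU (FemtoCurvatureSkewness_of h.1 h.2.1 h.2.2)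

/-- **A zero in a corner box contradicts E_R ∧ E_ρ given axis positivity** (the elementary mechanism behind the previous
remark, stated for one box): if `κ₃ = 0`, `C₀₃ = C₀₂ > 0`, `R₀ C₀₂C₀₃C₂₃ ≤ κ₃²` and `ρ₀ C₀₂ ≤ C₂₃` with `R₀, ρ₀ > 0`, absurd. -/
theorem no_zero_in_corner {R₀ ρ₀ X D k : ℝ} (hR₀ : 0 < R₀) (hρ₀ : 0 < ρ₀) (hX : 0 < X)
    (hR : R₀ * (X * X * D) ≤ k ^ 2) (hρ : ρ₀ * X ≤ D) (hk : k = 0) : False := by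
  subst hk
  have hD : 0 < D := lt_of_lt_of_le (mul_pos hρ₀ hX) hρ
  have hpos : 0 < R₀ * (X * X * D) := by positivity
  have h0 : (0 : ℝ) ^ 2 = 0 := by norm_num
  linarith

/-! ## Landed inputs of the line (tree theorems, used or cited by name) -/

-- Hypercubic symmetry `C₀₃ = C₀₂` — LANDED (p87496), used in `FemtoCurvatureSkewness_of`.
example :
  ∀ (G : Type) [Group G] [TopologicalSpace G] [IsTopologicalGroup G] [CompactSpace G]
    [MeasurableSpace G] [BorelSpace G] (r : LatticeRep G) (L : ℕ) [NeZero L] (β : ℝ) (n : ℕ),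
    wCov r L β (plaq r L 0 0 1) (plaq r L (Pi.single (3 : Fin 4) ((n : ℕ) : ZMod L)) 0 1) =
      wCov r L β (plaq r L 0 0 1) (plaq r L (Pi.single (2 : Fin 4) ((n : ℕ) : ZMod L)) 0 1) :=
  Summit.QuantumFields.YangMills.Theorems.FemtoCurvatureSkewness.HypercubicCovSymmetry

-- The Wick/Isserlis identity behind `R = 8/dim G` — LANDED (p88811) as `PermanentalRigidity` (tree-level input of E_R).
example := @Summit.QuantumFields.YangMills.Theorems.FemtoCurvatureSkewness.PermanentalRigidity

-- Transverse torus propagators `> 0` at `ne₂` and `n(e₃ − e₂)` — LANDED (p90356) as `PerpPropagatorPos` (tree-level input of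
-- E_R's sign and of E_ρ's `ρ_tree > 0`).
example := @Summit.QuantumFields.YangMills.Theorems.FemtoCurvatureSkewness.PerpPropagatorPos

end Summit.QuantumFields.YangMills.Cruxes.FemtoCurvatureSkewness.WickTriangleRatio

end
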